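import Summits.QuantumFields.BalabanUV.T4Continuum.Support.ShellMeasurePlaquetteCubicDictionary

/-!
# `T4Continuum.ShellMeasurePlaquetteCubicCovBinders` — row S65 f5d (part a, file 2∕2): THE THREE BINDERS OF THE
# `∇`-FREE PART `V0remCov` — the rotation remainder `mainTermSym − mainFlatSym` is a cubic-binder term with the SMALL
# factor `ε₀ = ‖U₀(∂p) − 1‖`; `hcub` ∕ `hloc` ∕ `ha` for `V0remCov` in row S65 f2a∕f2b's shapes
# (cell `pub-balaban`, sub-cell `t4`, spine estimate NE7c (node U5b), crew lineage `b2b-balaban-t4-ne7c-formalise-leaf-02`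
# gen 8, owner table `LEAVES-NE7c-P1.md` row S65; imports file 1∕2 `ShellMeasurePlaquetteCubicDictionary` ONLY;
# [folklore]; 0 sorry, 0 def)

HONEST FRAMING.  Finite four-torus programme, rung (B)+1 only — NOT infinite volume, NOT a mass gap, NOT the Clay
problem, NOT summit progress; (B), `BetaPertHyp`, (B^μ) are not consumed.  NE7c (`T4IndicatorShell.ShellWeightBound`)
is NOT PRINTED and NOT PROVED; «NE7c ⇐ the named binders» (WALL `t4/b2b-balaban-t4-ne7c-p1/WALL-NE7c-P1.md` §2).
ELEMENTARY estimates in a normed algebra ([folklore]); [Balaban1985Variational] (38)∕(39)∕(40) are LOCATORS for the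
shape only — the paper is under adjudication; nothing printed is asserted or cited as a fact; no `def` is minted.
HONEST DEPENDENCY (cell): continuum YM on T⁴ ⇐ BetaPertH ∧ nine spine estimates (0/9 proved); BetaPertH ⇐ (D1) ∧ (D4)
∧ CAP+tail; G-an2-4 gates asym, D1 and NE2/3/4.

THE POINT.  File 1∕2 rewrote the one-grid action's order-≥3 part as `cubT + Σ_p V0remCov_p` with
`V0remCov = V0remSym + (mainTermSym − mainFlatSym)`: leaf-03's `V₀′` plus a ROTATION REMAINDER coming from the background
plaquette holonomy `U₀(∂p)` that twists the last two letters (`tv 2 = R(U₀(∂p)) fv 2`, `tv 3 = R(U₀(∂p)) fv 3`).  Since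
`‖R(W)Y − Y‖ ≤ 2‖W − 1‖·‖Y‖` for a unit-bounded `W` (file 1 `norm_conjR_sub_self_le`), the rotation remainder carries the
SMALL factor `ε₀ = ‖U₀(∂p) − 1‖` — print's (38) «hidden small factor» in our typing — and is CUBIC in the field: it
belongs with `V₀′` in the `∇`-FREE part, under the (40)-shape binder.  THIS FILE:
* §2 `norm_symCubic_sub_le` (the symmetrised cubic word is `72σ²`-Lipschitz in the last two letters),
  **`norm_mainTermSym_sub_mainFlatSym_le`**: `‖mainTermSym − mainFlatSym‖ ≤ 72·‖τ‖·ε₀·σ³` for `‖A(bᵢ)‖ ≤ σ`,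
  **`norm_V0remCov_le_of_bonds`**: `‖V0remCov‖ ≤ ‖τ‖·((248∕3)ε₀σ³ + (40∕3)σ⁴)` (`4σ ≤ 1`; leaf-03's `(32∕3)ε₀σ³ + (40∕3)σ⁴`
  plus `72ε₀σ³`), **`hcub_V0remCov`**: `∀ A σ, 0 ≤ σ < s₀ → (‖A b′‖ ≤ σ on bonds bd) → ‖V0remCov τ U bd A‖ ≤
  ‖τ‖·(248∕3·ε₀ + 40∕3·s₀)·σ³` (`4s₀ ≤ 1`) — row S65 f2b's `hcub` LITERALLY at `W p = 1`, `κ` SMALL with `ε₀`, `s₀`;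
* §2b **`V0remCov_add_single`** (f2b's `hloc`: blind to bonds off `∂p`), **`analyticAt_V0remCov`** ∕
  `analyticOnNhd_V0remCov` (f2a's `ha`: entire).
So the `∇`-free plaquette family of file 1's `sum_ord₃_eq_cubT_add` inhabits the three binders of
`ShellMeasureGradientTailLevels.weighted_locGrad_le` ∕ `ShellMeasureMultiGridNorms.prop4Hyp_locGrad_levels` at one grid,
exactly as leaf-03's `V0remSym` did — J1 (leaf-01-g6) may swap `V0remSym ↦ V0remCov` by name.
NOT HERE: the weights∕`η`-currency at the live levels (J1), the `Prop4Hyp` assembly (part b), the HD-dressing (S66), [dict]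
(node O).  No estimate of Bałaban's at a live level is discharged.
-/

noncomputable section

open scoped BigOperators

namespace Summit.QuantumFields.BalabanUV.T4Continuum.ShellMeasurePlaquetteCubicCovBinders

open Literature.MathematicalPhysics.QuantumFieldTheory.Balaban1983to89
open B7Prop1Explicit (e U1 mem_U1)
open B7Eq78Linearization (conjR conjR_apply conjR_add conjR_sub conjR_smul)
open B8Eq146AExpansion (X1 X2 X3 X4 lin adR plaqCovDeriv)
open B8Eq151V2Divergence (brk)
open ShellMeasureWilsonGradientTail (letter plaqWord bonds)
open ShellMeasurePlaquetteTwist (twistVar letter_zero plaqFunSym)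
open ShellMeasurePlaquetteCubicSlice (norm_plaqWord_zero_le norm_inv_plaqWord_zero_le)
open ShellMeasurePlaquetteCubicSplit (pre tv)
open ShellMeasurePlaquetteCubicLocal (mainTermSym V0remSym norm_V0remSym_le_of_bonds fst_mem_bonds
  ord₃_plaqFunSym_add_single analyticAt_ord₃ analyticAt_mainTermSym)
open ShellMeasureCubicWord (curl4 comm4)
open ShellMeasureLocalGradientTailJet (ord₃)
open Summit.QuantumFields.BalabanUV.T4Continuum.ShellMeasureCommutatorVariation (cub)
open Summit.QuantumFields.BalabanUV.T4Continuum.ShellMeasureCommutatorLocGrad (ext ext_apply_of_mem cubT cubT_apply)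
open Summit.QuantumFields.BalabanUV.T4Continuum.ShellMeasurePlaquetteCubicDictionary

export B7Prop1Explicit (Site)

variable {Λ : Type*} {𝔸 : Type*} [NormedRing 𝔸] [NormedAlgebra ℂ 𝔸] [CompleteSpace 𝔸]

/-! ## §2 The rotation remainder is a `∇`-free cubic-binder term -/

section Rot

omit [NormedAlgebra ℂ 𝔸] [CompleteSpace 𝔸] in
/-- `‖curl4 y‖ ≤ Σ‖yᵢ‖`. [folklore] -/
theorem norm_curl4_le (y₀ y₁ y₂ y₃ : 𝔸) : ‖curl4 y₀ y₁ y₂ y₃‖ ≤ ‖y₀‖ + ‖y₁‖ + ‖y₂‖ + ‖y₃‖ := by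
  unfold curl4
  exact norm_add_le_of_le (norm_add_le_of_le (norm_add_le _ _) le_rfl) le_rfl

omit [NormedAlgebra ℂ 𝔸] [CompleteSpace 𝔸] in
/-- `‖curl4 y − curl4 z‖ ≤ Σ‖yᵢ − zᵢ‖`. [folklore] -/
theorem norm_curl4_sub_le (y₀ y₁ y₂ y₃ z₀ z₁ z₂ z₃ : 𝔸) :
    ‖curl4 y₀ y₁ y₂ y₃ - curl4 z₀ z₁ z₂ z₃‖ ≤ ‖y₀ - z₀‖ + ‖y₁ - z₁‖ + ‖y₂ - z₂‖ + ‖y₃ - z₃‖ := by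
  have h : curl4 y₀ y₁ y₂ y₃ - curl4 z₀ z₁ z₂ z₃ = (y₀ - z₀) + (y₁ - z₁) + (y₂ - z₂) + (y₃ - z₃) := by
    unfold curl4
    abel
  rw [h]
  exact norm_add_le_of_le (norm_add_le_of_le (norm_add_le _ _) le_rfl) le_rfl

omit [NormedAlgebra ℂ 𝔸] [CompleteSpace 𝔸] in
/-- `‖[a, b] − [a′, b′]‖ ≤ 2‖a − a′‖‖b‖ + 2‖a′‖‖b − b′‖`. [folklore] -/
theorem norm_comm_sub_comm_le (a b a' b' : 𝔸) :
    ‖(a * b - b * a) - (a' * b' - b' * a')‖ ≤ 2 * ‖a - a'‖ * ‖b‖ + 2 * ‖a'‖ * ‖b - b'‖ := by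
  have h : (a * b - b * a) - (a' * b' - b' * a') = ((a - a') * b - b * (a - a')) + (a' * (b - b') - (b - b') * a') := by
    noncomm_ring
  rw [h]
  refine norm_add_le_of_le ?_ ?_
  · calc _ ≤ ‖(a - a') * b‖ + ‖b * (a - a')‖ := norm_sub_le _ _
      _ ≤ ‖a - a'‖ * ‖b‖ + ‖b‖ * ‖a - a'‖ := add_le_add (norm_mul_le _ _) (norm_mul_le _ _)
      _ = 2 * ‖a - a'‖ * ‖b‖ := by ring
  · calc _ ≤ ‖a' * (b - b')‖ + ‖(b - b') * a'‖ := norm_sub_le _ _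
      _ ≤ ‖a'‖ * ‖b - b'‖ + ‖b - b'‖ * ‖a'‖ := add_le_add (norm_mul_le _ _) (norm_mul_le _ _)
      _ = 2 * ‖a'‖ * ‖b - b'‖ := by ring

omit [NormedAlgebra ℂ 𝔸] [CompleteSpace 𝔸] in
/-- `‖comm4 y‖ ≤ 12σ²` for `‖yᵢ‖ ≤ σ`. [folklore] -/
theorem norm_comm4_le {y₀ y₁ y₂ y₃ : 𝔸} {σ : ℝ} (h₀ : ‖y₀‖ ≤ σ) (h₁ : ‖y₁‖ ≤ σ) (h₂ : ‖y₂‖ ≤ σ) (h₃ : ‖y₃‖ ≤ σ) :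
    ‖comm4 y₀ y₁ y₂ y₃‖ ≤ 12 * σ ^ 2 := by
  have hσ : 0 ≤ σ := (norm_nonneg _).trans h₀
  have hc : ∀ {a b : 𝔸}, ‖a‖ ≤ σ → ‖b‖ ≤ σ → ‖a * b - b * a‖ ≤ 2 * σ ^ 2 := by
    intro a b ha hb
    calc _ ≤ ‖a * b‖ + ‖b * a‖ := norm_sub_le _ _
      _ ≤ ‖a‖ * ‖b‖ + ‖b‖ * ‖a‖ := add_le_add (norm_mul_le _ _) (norm_mul_le _ _)
      _ ≤ σ * σ + σ * σ := by gcongr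
      _ = 2 * σ ^ 2 := by ring
  unfold comm4
  calc _ ≤ 2 * σ ^ 2 + 2 * σ ^ 2 + 2 * σ ^ 2 + 2 * σ ^ 2 + 2 * σ ^ 2 + 2 * σ ^ 2 :=
        norm_add_le_of_le (norm_add_le_of_le (norm_add_le_of_le (norm_add_le_of_le (norm_add_le_of_le (hc h₀ h₁)
          (hc h₀ h₂)) (hc h₀ h₃)) (hc h₁ h₂)) (hc h₁ h₃)) (hc h₂ h₃)
    _ = 12 * σ ^ 2 := by ring

omit [NormedAlgebra ℂ 𝔸] [CompleteSpace 𝔸] in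
/-- `‖comm4 y − comm4 z‖ ≤ 6σ·Σ‖yᵢ − zᵢ‖` for `‖yᵢ‖, ‖zᵢ‖ ≤ σ` (each letter sits in three commutators). [folklore] -/
theorem norm_comm4_sub_le {y₀ y₁ y₂ y₃ z₀ z₁ z₂ z₃ : 𝔸} {σ : ℝ} (hy₀ : ‖y₀‖ ≤ σ) (hy₁ : ‖y₁‖ ≤ σ) (hy₂ : ‖y₂‖ ≤ σ)
    (hy₃ : ‖y₃‖ ≤ σ) (hz₀ : ‖z₀‖ ≤ σ) (hz₁ : ‖z₁‖ ≤ σ) (hz₂ : ‖z₂‖ ≤ σ) :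
    ‖comm4 y₀ y₁ y₂ y₃ - comm4 z₀ z₁ z₂ z₃‖ ≤
      6 * σ * (‖y₀ - z₀‖ + ‖y₁ - z₁‖ + ‖y₂ - z₂‖ + ‖y₃ - z₃‖) := by
  have hσ : 0 ≤ σ := (norm_nonneg _).trans hy₀
  have hc : ∀ {a b a' b' : 𝔸}, ‖b‖ ≤ σ → ‖a'‖ ≤ σ →
      ‖(a * b - b * a) - (a' * b' - b' * a')‖ ≤ 2 * σ * ‖a - a'‖ + 2 * σ * ‖b - b'‖ := by
    intro a b a' b' hb ha'
    calc _ ≤ 2 * ‖a - a'‖ * ‖b‖ + 2 * ‖a'‖ * ‖b - b'‖ := norm_comm_sub_comm_le a b a' b'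
      _ ≤ 2 * ‖a - a'‖ * σ + 2 * σ * ‖b - b'‖ := by gcongr
      _ = 2 * σ * ‖a - a'‖ + 2 * σ * ‖b - b'‖ := by ring
  have h : comm4 y₀ y₁ y₂ y₃ - comm4 z₀ z₁ z₂ z₃ =
      ((y₀ * y₁ - y₁ * y₀) - (z₀ * z₁ - z₁ * z₀)) + ((y₀ * y₂ - y₂ * y₀) - (z₀ * z₂ - z₂ * z₀))
      + ((y₀ * y₃ - y₃ * y₀) - (z₀ * z₃ - z₃ * z₀)) + ((y₁ * y₂ - y₂ * y₁) - (z₁ * z₂ - z₂ * z₁))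
      + ((y₁ * y₃ - y₃ * y₁) - (z₁ * z₃ - z₃ * z₁)) + ((y₂ * y₃ - y₃ * y₂) - (z₂ * z₃ - z₃ * z₂)) := by
    unfold comm4
    abel
  rw [h]
  calc _ ≤ (2 * σ * ‖y₀ - z₀‖ + 2 * σ * ‖y₁ - z₁‖) + (2 * σ * ‖y₀ - z₀‖ + 2 * σ * ‖y₂ - z₂‖)
      + (2 * σ * ‖y₀ - z₀‖ + 2 * σ * ‖y₃ - z₃‖) + (2 * σ * ‖y₁ - z₁‖ + 2 * σ * ‖y₂ - z₂‖)
      + (2 * σ * ‖y₁ - z₁‖ + 2 * σ * ‖y₃ - z₃‖) + (2 * σ * ‖y₂ - z₂‖ + 2 * σ * ‖y₃ - z₃‖) :=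
        norm_add_le_of_le (norm_add_le_of_le (norm_add_le_of_le (norm_add_le_of_le (norm_add_le_of_le
          (hc hy₁ hz₀) (hc hy₂ hz₀)) (hc hy₃ hz₀)) (hc hy₂ hz₁)) (hc hy₃ hz₁)) (hc hy₃ hz₂)
    _ = 6 * σ * (‖y₀ - z₀‖ + ‖y₁ - z₁‖ + ‖y₂ - z₂‖ + ‖y₃ - z₃‖) := by ring

omit [NormedAlgebra ℂ 𝔸] [CompleteSpace 𝔸] in
/-- THE TRILINEAR PERTURBATION: `‖(Y·K + K·Y) − (Z·K_Z + K_Z·Z)‖ ≤ 2(‖Y − Z‖·‖K‖ + ‖Z‖·‖K − K_Z‖)`. [folklore] -/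
theorem norm_sym_sub_sym_le (Y K Z L : 𝔸) :
    ‖(Y * K + K * Y) - (Z * L + L * Z)‖ ≤ 2 * (‖Y - Z‖ * ‖K‖ + ‖Z‖ * ‖K - L‖) := by
  have h : (Y * K + K * Y) - (Z * L + L * Z) = ((Y - Z) * K + Z * (K - L)) + (K * (Y - Z) + (K - L) * Z) := by
    noncomm_ring
  rw [h]
  calc _ ≤ ‖(Y - Z) * K + Z * (K - L)‖ + ‖K * (Y - Z) + (K - L) * Z‖ := norm_add_le _ _
    _ ≤ (‖Y - Z‖ * ‖K‖ + ‖Z‖ * ‖K - L‖) + (‖K‖ * ‖Y - Z‖ + ‖K - L‖ * ‖Z‖) :=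
        add_le_add (norm_add_le_of_le (norm_mul_le _ _) (norm_mul_le _ _))
          (norm_add_le_of_le (norm_mul_le _ _) (norm_mul_le _ _))
    _ = 2 * (‖Y - Z‖ * ‖K‖ + ‖Z‖ * ‖K - L‖) := by ring

omit [NormedAlgebra ℂ 𝔸] [CompleteSpace 𝔸] in
/-- THE CORE PERTURBATION ESTIMATE for the symmetrised cubic word: letters of size `σ`, the first two letters equal,
the last two `δ`-close in sum ⟹ `‖(Y·K + K·Y) − (Z·K_Z + K_Z·Z)‖ ≤ 72·σ²·δ`. [folklore] -/
theorem norm_symCubic_sub_le {y₀ y₁ y₂ y₃ z₀ z₁ z₂ z₃ : 𝔸} {σ δ : ℝ}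
    (hy₀ : ‖y₀‖ ≤ σ) (hy₁ : ‖y₁‖ ≤ σ) (hy₂ : ‖y₂‖ ≤ σ) (hy₃ : ‖y₃‖ ≤ σ)
    (hz₀ : ‖z₀‖ ≤ σ) (hz₁ : ‖z₁‖ ≤ σ) (hz₂ : ‖z₂‖ ≤ σ) (hz₃ : ‖z₃‖ ≤ σ)
    (hd : ‖y₀ - z₀‖ + ‖y₁ - z₁‖ + ‖y₂ - z₂‖ + ‖y₃ - z₃‖ ≤ δ) :
    ‖(curl4 y₀ y₁ y₂ y₃ * comm4 y₀ y₁ y₂ y₃ + comm4 y₀ y₁ y₂ y₃ * curl4 y₀ y₁ y₂ y₃)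
      - (curl4 z₀ z₁ z₂ z₃ * comm4 z₀ z₁ z₂ z₃ + comm4 z₀ z₁ z₂ z₃ * curl4 z₀ z₁ z₂ z₃)‖ ≤ 72 * σ ^ 2 * δ := by
  have hσ : 0 ≤ σ := (norm_nonneg _).trans hy₀
  have hδ : 0 ≤ δ := le_trans (by positivity) hd
  have hY : ‖curl4 y₀ y₁ y₂ y₃ - curl4 z₀ z₁ z₂ z₃‖ ≤ δ := (norm_curl4_sub_le _ _ _ _ _ _ _ _).trans hd
  have hK : ‖comm4 y₀ y₁ y₂ y₃‖ ≤ 12 * σ ^ 2 := norm_comm4_le hy₀ hy₁ hy₂ hy₃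
  have hZ : ‖curl4 z₀ z₁ z₂ z₃‖ ≤ 4 * σ := by
    refine (norm_curl4_le _ _ _ _).trans ?_
    linarith
  have hKL : ‖comm4 y₀ y₁ y₂ y₃ - comm4 z₀ z₁ z₂ z₃‖ ≤ 6 * σ * δ :=
    (norm_comm4_sub_le hy₀ hy₁ hy₂ hy₃ hz₀ hz₁ hz₂).trans (by gcongr)
  refine (norm_sym_sub_sym_le _ _ _ _).trans ?_
  calc 2 * (‖curl4 y₀ y₁ y₂ y₃ - curl4 z₀ z₁ z₂ z₃‖ * ‖comm4 y₀ y₁ y₂ y₃‖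
        + ‖curl4 z₀ z₁ z₂ z₃‖ * ‖comm4 y₀ y₁ y₂ y₃ - comm4 z₀ z₁ z₂ z₃‖)
      ≤ 2 * (δ * (12 * σ ^ 2) + (4 * σ) * (6 * σ * δ)) := by gcongr
    _ = 72 * σ ^ 2 * δ := by ring

variable [Fintype Λ] [NormOneClass 𝔸] (τ : 𝔸 →L[ℂ] ℂ) {U : Λ → 𝔸ˣ} (hU : ∀ b, ‖(U b : 𝔸)‖ ≤ 1)
  (hU' : ∀ b, ‖(((U b)⁻¹ : 𝔸ˣ) : 𝔸)‖ ≤ 1) (bd : Fin 4 → Λ × Bool)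
  (h0 : (bd 0).2 = true) (h1 : (bd 1).2 = true) (h2 : (bd 2).2 = false) (h3 : (bd 3).2 = false)
include hU hU'

omit [CompleteSpace 𝔸] [Fintype Λ] [NormOneClass 𝔸] in
/-- The flat variables have the size of the field: `‖fv i‖ ≤ σ` for `‖A(bᵢ)‖ ≤ σ`. [folklore] -/
theorem norm_fv_le {A : Λ → 𝔸} {σ : ℝ} (hA : ∀ i, ‖A (bd i).1‖ ≤ σ) (i : Fin 4) : ‖fv U bd A i‖ ≤ σ := by
  have hI : ∀ j, ‖Complex.I • A (bd j).1‖ ≤ σ := fun j => by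
    rw [norm_smul, Complex.norm_I, one_mul]
    exact hA j
  match i with
  | ⟨0, _⟩ => exact hI 0
  | ⟨1, _⟩ => exact (norm_conjR_le (hU _) (hU' _) _).trans (hI 1)
  | ⟨2, _⟩ =>
    refine (norm_conjR_le (hU _) (hU' _) _).trans ?_
    rw [norm_neg]
    exact hI 2
  | ⟨3, _⟩ =>
    show ‖-(Complex.I • A (bd 3).1)‖ ≤ σ
    rw [norm_neg]
    exact hI 3


include h0 h1 h2 h3

/-- The twisted variables have the size of the field: `‖tv i‖ ≤ σ` for `‖A(bᵢ)‖ ≤ σ`. [folklore] -/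
theorem norm_tv_le {A : Λ → 𝔸} {σ : ℝ} (hA : ∀ i, ‖A (bd i).1‖ ≤ σ) (i : Fin 4) : ‖tv U bd A i‖ ≤ σ := by
  have hW : ‖(plaqWord U bd (0 : Λ → 𝔸) : 𝔸)‖ ≤ 1 := norm_plaqWord_zero_le hU hU' bd
  have hWi : ‖(((plaqWord U bd (0 : Λ → 𝔸))⁻¹ : 𝔸ˣ) : 𝔸)‖ ≤ 1 := norm_inv_plaqWord_zero_le hU hU' bd
  have hf := norm_fv_le hU hU' bd hA
  match i with
  | ⟨0, _⟩ =>
    rw [show (⟨0, _⟩ : Fin 4) = 0 from rfl, tv_zero U bd h0]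
    exact hf 0
  | ⟨1, _⟩ =>
    rw [show (⟨1, _⟩ : Fin 4) = 1 from rfl, tv_one U bd h0 h1]
    exact hf 1
  | ⟨2, _⟩ =>
    rw [show (⟨2, _⟩ : Fin 4) = 2 from rfl, tv_two U bd h0 h1 h2 h3]
    exact (norm_conjR_le hW hWi _).trans (hf 2)
  | ⟨3, _⟩ =>
    rw [show (⟨3, _⟩ : Fin 4) = 3 from rfl, tv_three U bd h0 h1 h2 h3]
    exact (norm_conjR_le hW hWi _).trans (hf 3)

/-- THE ROTATION DEFECT of the last two letters: `‖tv 2 − fv 2‖, ‖tv 3 − fv 3‖ ≤ 2ε₀σ` for `‖U₀(∂p) − 1‖ ≤ ε₀`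
(leaf-03's ONE regularity number; `‖U₀(∂p)⁻¹ − 1‖ ≤ ε₀` follows for a unit-bounded background). [folklore] -/
theorem norm_tv_sub_fv_le {A : Λ → 𝔸} {σ ε₀ : ℝ} (hA : ∀ i, ‖A (bd i).1‖ ≤ σ)
    (hε₀ : ‖(plaqWord U bd (0 : Λ → 𝔸) : 𝔸) - 1‖ ≤ ε₀) :
    ‖tv U bd A 2 - fv U bd A 2‖ ≤ 2 * ε₀ * σ ∧ ‖tv U bd A 3 - fv U bd A 3‖ ≤ 2 * ε₀ * σ := by
  have hε : 0 ≤ ε₀ := (norm_nonneg _).trans hε₀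
  have hWi : ‖(((plaqWord U bd (0 : Λ → 𝔸))⁻¹ : 𝔸ˣ) : 𝔸)‖ ≤ 1 := norm_inv_plaqWord_zero_le hU hU' bd
  have hε₀' : ‖(((plaqWord U bd (0 : Λ → 𝔸))⁻¹ : 𝔸ˣ) : 𝔸) - 1‖ ≤ ε₀ :=
    (ShellMeasurePlaquetteCubicLocal.norm_inv_sub_one_le hWi).trans hε₀
  have hf := norm_fv_le hU hU' bd hA
  have hrot : ∀ Y : 𝔸, ‖Y‖ ≤ σ → ‖conjR (plaqWord U bd 0) Y - Y‖ ≤ 2 * ε₀ * σ :=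
    fun Y hY => (norm_conjR_sub_self_le hε₀ hε₀' hWi Y).trans (by gcongr)
  rw [tv_two U bd h0 h1 h2 h3, tv_three U bd h0 h1 h2 h3]
  exact ⟨hrot _ (hf 2), hrot _ (hf 3)⟩

/-- **THE ROTATION REMAINDER IS A `∇`-FREE CUBIC-BINDER TERM**: for a unit-bounded background with
`‖U₀(∂p) − 1‖ ≤ ε₀` and `‖A(bᵢ)‖ ≤ σ`, `‖mainTermSym τ U bd A − mainFlatSym τ U bd A‖ ≤ 72·‖τ‖·ε₀·σ³`. [folklore] -/
theorem norm_mainTermSym_sub_mainFlatSym_le {A : Λ → 𝔸} {σ ε₀ : ℝ} (hA : ∀ i, ‖A (bd i).1‖ ≤ σ)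
    (hε₀ : ‖(plaqWord U bd (0 : Λ → 𝔸) : 𝔸) - 1‖ ≤ ε₀) :
    ‖mainTermSym τ U bd A - mainFlatSym τ U bd A‖ ≤ 72 * ‖τ‖ * ε₀ * σ ^ 3 := by
  have ht := norm_tv_le hU hU' bd h0 h1 h2 h3 hA
  have hf := norm_fv_le hU hU' bd hA
  obtain ⟨hd2, hd3⟩ := norm_tv_sub_fv_le hU hU' bd h0 h1 h2 h3 hA hε₀
  have hd : ‖tv U bd A 0 - fv U bd A 0‖ + ‖tv U bd A 1 - fv U bd A 1‖ + ‖tv U bd A 2 - fv U bd A 2‖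
      + ‖tv U bd A 3 - fv U bd A 3‖ ≤ 4 * ε₀ * σ := by
    rw [tv_zero U bd h0, tv_one U bd h0 h1, sub_self, sub_self, norm_zero]
    linarith
  have hin := norm_symCubic_sub_le (ht 0) (ht 1) (ht 2) (ht 3) (hf 0) (hf 1) (hf 2) (hf 3) hd
  have hdiff : mainTermSym τ U bd A - mainFlatSym τ U bd A =
      -((4 : ℂ)⁻¹ * τ ((curl4 (tv U bd A 0) (tv U bd A 1) (tv U bd A 2) (tv U bd A 3)
          * comm4 (tv U bd A 0) (tv U bd A 1) (tv U bd A 2) (tv U bd A 3)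
        + comm4 (tv U bd A 0) (tv U bd A 1) (tv U bd A 2) (tv U bd A 3)
          * curl4 (tv U bd A 0) (tv U bd A 1) (tv U bd A 2) (tv U bd A 3))
        - (curl4 (fv U bd A 0) (fv U bd A 1) (fv U bd A 2) (fv U bd A 3)
          * comm4 (fv U bd A 0) (fv U bd A 1) (fv U bd A 2) (fv U bd A 3)
        + comm4 (fv U bd A 0) (fv U bd A 1) (fv U bd A 2) (fv U bd A 3)
          * curl4 (fv U bd A 0) (fv U bd A 1) (fv U bd A 2) (fv U bd A 3)))) := by
    rw [mainTermSym, mainFlatSym, map_sub]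
    ring
  rw [hdiff, norm_neg, norm_mul, norm_inv, RCLike.norm_ofNat]
  calc _ ≤ (4 : ℝ)⁻¹ * (‖τ‖ * (72 * σ ^ 2 * (4 * ε₀ * σ))) := by
        gcongr
        exact (τ.le_opNorm _).trans (by gcongr)
    _ = 72 * ‖τ‖ * ε₀ * σ ^ 3 := by ring

/-- **THE CUBIC BINDER OF THE `∇`-FREE PART** in the field's size: `‖A(bᵢ)‖ ≤ σ`, `4σ ≤ 1`, `‖U₀(∂p) − 1‖ ≤ ε₀` ⟹
`‖V0remCov τ U bd A‖ ≤ ‖τ‖·((248∕3)·ε₀·σ³ + (40∕3)·σ⁴)` (leaf-03's `(32∕3)ε₀σ³ + (40∕3)σ⁴` for `V₀′` plus `72ε₀σ³`).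
[folklore] -/
theorem norm_V0remCov_le_of_bonds {A : Λ → 𝔸} {σ ε₀ : ℝ} (hε₀ : ‖(plaqWord U bd (0 : Λ → 𝔸) : 𝔸) - 1‖ ≤ ε₀)
    (hA : ∀ i, ‖A (bd i).1‖ ≤ σ) (hσ : 4 * σ ≤ 1) :
    ‖V0remCov τ U bd A‖ ≤ ‖τ‖ * (248 / 3 * ε₀ * σ ^ 3 + 40 / 3 * σ ^ 4) := by
  rw [V0remCov_eq]
  refine (norm_add_le_of_le (norm_V0remSym_le_of_bonds hU hU' τ bd hε₀ hA hσ)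
    (norm_mainTermSym_sub_mainFlatSym_le τ hU hU' bd h0 h1 h2 h3 hA hε₀)).trans_eq ?_
  ring

/-- **THE CUBIC BINDER IN ROW S65 f2b's `hcub` SHAPE** (one grid, `W p = 1`): with `4s₀ ≤ 1`, for ALL `A`, `σ` with
`0 ≤ σ < s₀` and `‖A b′‖ ≤ σ` on `bonds bd`: `‖V0remCov τ U bd A‖ ≤ ‖τ‖·(248∕3·ε₀ + 40∕3·s₀)·σ³` — `κ` SMALL with the
background's plaquette regularity `ε₀` and the field cap `s₀`. [folklore] -/
theorem hcub_V0remCov [DecidableEq Λ] {ε₀ s₀ : ℝ} (hε₀ : ‖(plaqWord U bd (0 : Λ → 𝔸) : 𝔸) - 1‖ ≤ ε₀)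
    (hs₀ : 4 * s₀ ≤ 1) :
    ∀ (A : Λ → 𝔸) (σ : ℝ), 0 ≤ σ → σ < s₀ → (∀ b' ∈ bonds bd, ‖A b'‖ ≤ σ) →
      ‖V0remCov τ U bd A‖ ≤ ‖τ‖ * (248 / 3 * ε₀ + 40 / 3 * s₀) * σ ^ 3 := by
  intro A σ hσ0 hσ hA
  have hε : 0 ≤ ε₀ := (norm_nonneg _).trans hε₀
  have hA' : ∀ i, ‖A (bd i).1‖ ≤ σ := fun i => hA _ (fst_mem_bonds bd i)
  have h := norm_V0remCov_le_of_bonds τ hU hU' bd h0 h1 h2 h3 hε₀ hA' (by linarith)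
  refine h.trans ?_
  have hτ0 : 0 ≤ ‖τ‖ := norm_nonneg _
  have h4 : σ ^ 4 ≤ s₀ * σ ^ 3 := by nlinarith [pow_nonneg hσ0 3]
  nlinarith [pow_nonneg hσ0 3, mul_nonneg hτ0 (pow_nonneg hσ0 3), mul_nonneg hε (pow_nonneg hσ0 3)]

end Rot

/-! ## §2b Locality and analyticity of the `∇`-free part -/

section LocalAnalytic

variable [DecidableEq Λ] (τ : 𝔸 →L[ℂ] ℂ) (U : Λ → 𝔸ˣ) (bd : Fin 4 → Λ × Bool)

omit [CompleteSpace 𝔸] in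
/-- The flat variables read the field on `∂p` only. [folklore] -/
theorem fv_add_single (A : Λ → 𝔸) {b : Λ} (hb : b ∉ bonds bd) (X : 𝔸) (i : Fin 4) :
    fv U bd (A + Pi.single b X) i = fv U bd A i := by
  have hne : ∀ j, (bd j).1 ≠ b := fun j h => hb (Finset.mem_image.2 ⟨j, Finset.mem_univ _, h⟩)
  have hev : ∀ j, (A + Pi.single b X : Λ → 𝔸) (bd j).1 = A (bd j).1 := fun j => by
    simp only [Pi.add_apply, Pi.single_eq_of_ne (hne j), add_zero]
  match i with
  | ⟨0, _⟩ => simp only [fv, hev]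
  | ⟨1, _⟩ => simp only [fv, hev]
  | ⟨2, _⟩ => simp only [fv, hev]
  | ⟨3, _⟩ => simp only [fv, hev]

variable [Fintype Λ]

omit [CompleteSpace 𝔸] [Fintype Λ] in
/-- … hence so does the flat main term. [folklore] -/
theorem mainFlatSym_add_single (A : Λ → 𝔸) {b : Λ} (hb : b ∉ bonds bd) (X : 𝔸) :
    mainFlatSym τ U bd (A + Pi.single b X) = mainFlatSym τ U bd A := by
  simp only [mainFlatSym, fv_add_single U bd A hb X]

/-- **LOCALITY OF THE `∇`-FREE PART** (row S65 f2b's `hloc`): `V0remCov τ U bd (A + Pi.single b X) = V0remCov τ U bd A`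
for `b ∉ bonds bd`. [folklore] -/
theorem V0remCov_add_single [NormOneClass 𝔸] {U : Λ → 𝔸ˣ} (hU : ∀ b, ‖(U b : 𝔸)‖ ≤ 1)
    (hU' : ∀ b, ‖(((U b)⁻¹ : 𝔸ˣ) : 𝔸)‖ ≤ 1) (A : Λ → 𝔸) {b : Λ} (hb : b ∉ bonds bd) (X : 𝔸) :
    V0remCov τ U bd (A + Pi.single b X) = V0remCov τ U bd A := by
  rw [V0remCov, V0remCov, ord₃_plaqFunSym_add_single hU hU' τ bd A hb, mainFlatSym_add_single τ U bd A hb]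

omit [DecidableEq Λ] [CompleteSpace 𝔸] in
/-- Each flat variable is analytic (indeed linear) in the field. [folklore] -/
theorem analyticAt_fv (i : Fin 4) (A₀ : Λ → 𝔸) : AnalyticAt ℂ (fun A : Λ → 𝔸 => fv U bd A i) A₀ := by
  have hb : ∀ j, AnalyticAt ℂ (fun A : Λ → 𝔸 => Complex.I • A (bd j).1) A₀ := fun j =>
    ((ContinuousLinearMap.proj (R := ℂ) (φ := fun _ : Λ => 𝔸) (bd j).1).analyticAt A₀).fun_const_smul
  match i with
  | ⟨0, _⟩ => exact hb 0
  | ⟨1, _⟩ =>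
    show AnalyticAt ℂ (fun A : Λ → 𝔸 => conjR (U (bd 0).1) (Complex.I • A (bd 1).1)) A₀
    simp only [conjR_apply]
    exact (analyticAt_const.fun_mul (hb 1)).fun_mul analyticAt_const
  | ⟨2, _⟩ =>
    show AnalyticAt ℂ (fun A : Λ → 𝔸 => conjR (U (bd 3).1) (-(Complex.I • A (bd 2).1))) A₀
    simp only [conjR_apply]
    exact (analyticAt_const.fun_mul (hb 2).fun_neg).fun_mul analyticAt_const
  | ⟨3, _⟩ => exact (hb 3).fun_neg

omit [DecidableEq Λ] [CompleteSpace 𝔸] in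
/-- The flat main term is analytic in the field. [folklore] -/
theorem analyticAt_mainFlatSym (A₀ : Λ → 𝔸) : AnalyticAt ℂ (mainFlatSym τ U bd) A₀ := by
  have h0 := analyticAt_fv U bd 0 A₀
  have h1 := analyticAt_fv U bd 1 A₀
  have h2 := analyticAt_fv U bd 2 A₀
  have h3 := analyticAt_fv U bd 3 A₀
  have hY : AnalyticAt ℂ (fun A => curl4 (fv U bd A 0) (fv U bd A 1) (fv U bd A 2) (fv U bd A 3)) A₀ := by
    unfold curl4
    exact ((h0.fun_add h1).fun_add h2).fun_add h3
  have hK : AnalyticAt ℂ (fun A => comm4 (fv U bd A 0) (fv U bd A 1) (fv U bd A 2) (fv U bd A 3)) A₀ := by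
    unfold comm4
    exact ((((((h0.fun_mul h1).fun_sub (h1.fun_mul h0)).fun_add ((h0.fun_mul h2).fun_sub (h2.fun_mul h0))).fun_add
      ((h0.fun_mul h3).fun_sub (h3.fun_mul h0))).fun_add ((h1.fun_mul h2).fun_sub (h2.fun_mul h1))).fun_add
      ((h1.fun_mul h3).fun_sub (h3.fun_mul h1))).fun_add ((h2.fun_mul h3).fun_sub (h3.fun_mul h2))
  have hin : AnalyticAt ℂ (fun A => τ (curl4 (fv U bd A 0) (fv U bd A 1) (fv U bd A 2) (fv U bd A 3)
      * comm4 (fv U bd A 0) (fv U bd A 1) (fv U bd A 2) (fv U bd A 3)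
      + comm4 (fv U bd A 0) (fv U bd A 1) (fv U bd A 2) (fv U bd A 3)
      * curl4 (fv U bd A 0) (fv U bd A 1) (fv U bd A 2) (fv U bd A 3))) A₀ :=
    (τ.analyticAt _).comp ((hY.fun_mul hK).fun_add (hK.fun_mul hY))
  exact (analyticAt_const.fun_mul hin).fun_neg

omit [DecidableEq Λ] in
/-- **THE `∇`-FREE PART IS ANALYTIC EVERYWHERE** (row S65 f2a's `ha`). [folklore] -/
theorem analyticAt_V0remCov [NormOneClass 𝔸] {U : Λ → 𝔸ˣ} (hU : ∀ b, ‖(U b : 𝔸)‖ ≤ 1)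
    (hU' : ∀ b, ‖(((U b)⁻¹ : 𝔸ˣ) : 𝔸)‖ ≤ 1) (A₀ : Λ → 𝔸) : AnalyticAt ℂ (V0remCov τ U bd) A₀ :=
  (analyticAt_ord₃ (ShellMeasurePlaquetteTwist.analyticAt_plaqFunSym hU hU' τ bd A₀)).fun_sub
    (analyticAt_mainFlatSym τ U bd A₀)

omit [DecidableEq Λ] in
/-- … hence on every set. [folklore] -/
theorem analyticOnNhd_V0remCov [NormOneClass 𝔸] {U : Λ → 𝔸ˣ} (hU : ∀ b, ‖(U b : 𝔸)‖ ≤ 1)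
    (hU' : ∀ b, ‖(((U b)⁻¹ : 𝔸ˣ) : 𝔸)‖ ≤ 1) (s : Set (Λ → 𝔸)) : AnalyticOnNhd ℂ (V0remCov τ U bd) s :=
  fun A _ => analyticAt_V0remCov τ bd hU hU' A

end LocalAnalytic

end Summit.QuantumFields.BalabanUV.T4Continuum.ShellMeasurePlaquetteCubicCovBinders

end
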